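import Summits.QuantumFields.YangMills.Theorems.BalabanUVNodesN21GappedTopPairReading13CoPH
import Summits.QuantumFields.YangMills.Theorems.BalabanUVNodesN20OffLiveOneTermReadingCmap

/-!
# N21's DOUBLY-GAPPED SPINE READING, χ-GENERIC («Cmap») — E1 ∕ E2 AT ITS CARRIERS ON THE LIVE LINE, THE EXTRACTION FACE (N27x) AT `crGap2₁₃VAtCmap` ∕ AT THE K3ᴬ v8 PIN's
# READING `crGap2₁₃VAx`, AND v8's `KeyedExtractionV` CONJUNCT ON THE GAP-PINNED SPLIT READING — A THEOREM (any cut reading); the stub-2 bill reduced accordingly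

Cell `pub-ymgap` (HUMAN RULING D-0062, Track A), seat `pub-ymgap-dag-n20-d` (gen 46; R134 (a) N20 s3; op-5c-class K3ᴬ supply, `--kind proof --supports stmt-QuantumFields-27247 --as helper`;
count-neutral; proves NO registered stub).  CROSS-LANE χ-TWIN, declared as such: §1 is dag-n21-d's `Thm/BalabanUVNodesN21GappedTopPairReading13CoPH`
`sum_topTerm2AtLevel_eq_schemeZ_of_liveSel` and `…Faces` §F1 (`sum_classSet₁₃_gapWeight2A∕B₁₃(_eq_schemeZ)`, `keyedExtraction_crGap2₁₃VAt`) RE-KEYED over the β-slot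
(`hP : θ.Provisos₁₃CoPH ↦ (χ, hP : θ.Provisos₁₃CoPHChi F N χ)`, `histA∕B₁₃ ↦ histA∕B₁₃Chi`, `keyA∕B₁₃ ↦ keyA∕B₁₃Chi`, `classSet₁₃ ↦ classSet₁₃Chi`, `datumOfRecord₁₃CoPH ↦ datumOfRecord₁₃CoPHChi`,
`gapWeight2A∕B₁₃ ↦ gapWeight2A∕B₁₃Chi` — dag-n15-a's `…DefsCmap` T4, the pattern of this lineage's `…SpineReadingOfRecord13CoPHChiExtraction` ✓p807172 for the ungapped reading), proofs
through the parents' DATUM-GENERIC lemmas (`sum_classWeightOfDatum₉_eq_schemeZ_of_ppSelLive_of_localBg`, `sum_topClassWeight2At_eq`, `integrable_chi_mul_dressedSlots_of_ppSelLive`).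
No n21 ∕ n27 ∕ n19 seat has been on the bus since 2026-08-31T00:32Z; census: consumers of `crGap2₁₃VAtCmap ∕ crGap2₁₃VAx` = dag-n15-a's Defs + this lineage's g46 files only.  (H-ζ) is the
provisos' ROW `zetaMeas` (v1.8), so NO hypothesis beyond the live-selector pin enters.
[LF-I] = [Balaban1989LargeFieldI], [LF-II] = [Balaban1989LargeFieldII], [III] = [Balaban1988Convergent].

CONTENTS.  §1 ★ `sum_topTerm2AtLevel_eq_schemeZ_of_liveSel_chi` (θ-level, any χ: the pair-lettered top terms of a run sum to the χ-datum's dressed partition function on the live line,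
EVERY letter pair) · `sum_classSet₁₃Chi_gapWeight2A∕B₁₃Chi` (fibre sums) · ★★ `sum_classSet₁₃Chi_gapWeight2A∕B₁₃Chi_eq_schemeZ` (E1 ∕ E2 at the doubly-gapped χ-carriers, ANY dials, ANY cut).
§2 ★★ `extraction_crGap2₁₃VAtCmap_of_liveSel` (the four-clause extraction statement AT THE READING, any `Χ K₀ jcut ρ ρ′ n₁ n₂`, every χ-keyed tuple on the live line, every `g₀ os`).
§3 AT THE MIRROR (`N = 2`, re-centred): ★★★ `keyedExtraction_faces_of_liveGap2Pin` — v8's OWN pin `PinnedAtLiveGap2 jc ρ ρ′ n₁ n₂ cr` (ANY cut reading `jc`) + the off-live pin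
to `crOneTerm₁₃Ax 0` (✓p813406) ⟹ `KeyedExtractionBFree cr ∧ KeyedExtractionV cr`, HYPOTHESIS-FREE beyond the two pins: THE N27x CONJUNCT OF `stub_expansion13HV` IS A THEOREM on
the split reading; ★★ `exists_gap2PinnedSplitReading_extractionV` (the split reading minted with its pins and the N27x conjunct) ∕ `…_relWeight_extractionV_cutZero` (+ N20 at
the zero cut reading).  §4 ★★ THE BILL REDUCED `stub2Text_of_liveShellCore_cutZero`: per `β` and guarded K4-faced reading, dials with `DialRows` + N21's `ShellWeightBound` and N19′'s slot-keyed
`NE7.Core` at `crGap2₁₃VAx (fun _ ↦ 0) ρ ρ′ n₁ n₂` ON THE LIVE LINE + node U5's target OFF it ⟹ THE REGISTERED STUB-2 TEXT (byte for byte; N20, N27x and the pin paid by name).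
After this file a v8 stub-2 closer at the zero cut owes: the dial rows, N21's sign-free shell bound at the cut-zero doubly-gapped RE-CENTRED reading on the live line (dag-n21-w7's
`shellWeightBound_crGap2₁₃VAt_signFree` χ-twin — UNTYPED), N19′'s core there on ALL keyed classes (NE7 proper — NOT PRINTED for `d = 4`), node U5's target off the line (NOT PRINTED).

HONEST FRAMING.  [folklore] Fubini ∕ fibre-sum bookkeeping BY NAME on the parents' datum-generic identities; NO estimate of Bałaban's; E1 ∕ E2 are the partition-of-unity identities of
[LF-I] (0.3)–(0.4) read at the χ-datum, not a bound; §4's live-line N21 ∕ N19′ faces and the off-live target are the OTHER lanes' content, HYPOTHESES asserted for no family; NO stub of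
K3ᴬ v8 is closed or claimed (0∕2); no `Provisos₁₃CoPHChi ∕ …Ax` inhabitant claimed (K0ᴬ OPEN); N19 ∕ N20 ∕ N21 ∕ N27 NOT discharged; counts UNMOVED (typed 28∕28 · discharged 8∕27 · A 8∕28 ·
K 1∕4).  One finite `𝕋⁴_{L^K}` programme at fixed `ε = L^{−K}`, Bałaban AS PRINTED — NOT ℝ⁴, NOT infinite volume, NOT OS, NOT a mass gap; the YM mass gap (Clay) is NOT proved by any
of this.  No `def`, no `instance`, no `notation`, no `sorry`, standard axioms.
Sources (locators, bookkeeping only): [LF-I] (0.3)–(0.4) p.176, p.181; [LF-II] Thm 1 + (0.1) pp.355–356, (1.80) p.384; [III] (2.18) p.257, (3.16) p.268; [Balaban1985UV3] (6) p.257.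
-/

set_option autoImplicit false

noncomputable section

open scoped BigOperators
open Finset MeasureTheory

namespace Summit.QuantumFields.YangMills.Theorems.N21GappedTopPair13CoPH

open Literature.MathematicalPhysics.QuantumFieldTheory.Balaban1983to89
open Literature.MathematicalPhysics.QuantumFieldTheory.Balaban1983to89.T4Continuum
open Literature.MathematicalPhysics.QuantumFieldTheory.Balaban1983to89.Node00
open Literature.MathematicalPhysics.QuantumFieldTheory.Balaban1983to89.T4ContinuumYM4Torus (ForSmallCouplings)
open Summit.QuantumFields.BalabanUV.T4Continuum.Spine
open T4IndicatorShell (ShellWeightBound)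
open YMDAG.UVSplit (runA₁₃ runB₁₃ keyA₁₃Chi keyB₁₃Chi histA₁₃Chi histB₁₃Chi histA₁₃Chi_zero histB₁₃Chi_zero classSet₁₃Chi badClass₁₃Chi SpineReading₁₃CoPHCmap
  SpineReading₁₃CoPHAx classSet₁₃Ax badClass₁₃Ax)
open Summit.QuantumFields.YangMills.Theorems.N21StepWeightsPositivity (zetaOfRecord_nonneg)
open Summit.QuantumFields.YangMills.BalabanUVNodes.N19MGFFormAtRecordMass (sum_classWeightOfDatum₉_eq_schemeZ_of_ppSelLive_of_localBg)
open Summit.QuantumFields.YangMills.Theorems.N21ShellSplitOfRecord13CoPH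
open Summit.QuantumFields.YangMills.Theorems.K3AxV8Defs
open Summit.QuantumFields.YangMills.BalabanUVNodes.N20OffLiveOneTermReadingCmap (crOneTerm₁₃Ax keyedExtractionBFree_of_livePin exists_reading_livePin
  keyedRelWeight_of_liveGap2Pin_cutZero keyedShellWeight_of_livePin keyedCoreEdgeHolderD4V_of_livePin)

variable {F : T4Family} {N : ℕ} [NeZero N]

/-! ## §1 E1 ∕ E2 at the doubly-gapped χ-carriers on the live-selector line -/

section E1E2

variable (θ : Stage13HParams F N) (χ : ChiSlot F N) (hP : θ.Provisos₁₃CoPHChi F N χ)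

/-- ★ **THE PAIR-LETTERED TOP TERMS OF A RUN SUM TO THE χ-DATUM's DRESSED PARTITION FUNCTION, FOR EVERY LETTER PAIR** (`j = p.K`), at a χ-keyed Stage-13 tuple on the live-selector
line: level `0`: E1 of the record (`sum_classWeightOfDatum₉_eq_schemeZ_of_ppSelLive_of_localBg` at the χ-datum); level `k + 1`: the (RT) transport identity `sum_topClassWeight2At_eq` then
E1 at level `k`.  The rows `0 ≤ ζ`, `Σ|ζ| ≤ 1`, unity, (H-ζ) are the provisos' (`zetaUnity ∕ zetaAbs ∕ zetaMeas`); χ-twin of the parent's `sum_topTerm2AtLevel_eq_schemeZ_of_liveSel`.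
[cite: Balaban1989LargeFieldI, (0.3)–(0.4) p.176; Balaban1985UV3, (6) p.257; Balaban1988Convergent, (3.16) p.268 (bookkeeping)] -/
theorem sum_topTerm2AtLevel_eq_schemeZ_of_liveSel_chi (E : B12.RunParams → ℝ)
    (hsel : θ.ppSel = ppSelLiveOfRecord F N θ.ν θ.τ9 E (wOfRecord₉ F N θ.toStage9Params)) (g₀ : ℕ → ℝ) (os : List (ULoop F))
    {p : B12.RunParams} {g : ℕ → ℝ} (hg : g 0 = g₀ p.K) (θtop δtop t : ℝ) :
    ∀ j : ℕ, j = p.K → ∑ s, topTerm2AtLevel F N θ.toStage9Params (datumOfRecord₁₃CoPHChi F N θ χ hP) g₀ os p g θtop δtop t j s =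
      T4GenFunBounds.schemeZ ((datumOfRecord₁₃CoPHChi F N θ χ hP).scheme g₀) os p.K t := by
  have hζ0 : ∀ p g k s Pl Ql RS U V', 0 ≤ θ.ζ p g k s Pl Ql RS U V' :=
    fun p g k s Pl Ql RS U V' => zetaOfRecord_nonneg F N θ.ν θ.τ9.M hP.zetaUnity hP.zetaAbs p g k s Pl Ql RS U V'
  have hU : LocalBgMeasurable F N θ.ν := localBgMeasurable F N θ.ν
  have hD : (datumOfRecord₁₃CoPHChi F N θ χ hP).AvgMeasurable := (isPrintedAveraged_datumOfRecord₁₃CoPH_chi F N θ χ hP).avgMeasurable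
  intro j hj
  cases j with
  | zero =>
    simp only [topTerm2AtLevel_zero]
    exact sum_classWeightOfDatum₉_eq_schemeZ_of_ppSelLive_of_localBg θ.toStage9Params E hsel hg hU hP.zetaMeas hζ0 hP.zetaAbs hP.zetaUnity
      (datumOfRecord₁₃CoPHChi F N θ χ hP) hD os t 0 (Nat.zero_le _)
  | succ k =>
    simp only [topTerm2AtLevel_succ]
    rw [sum_topClassWeight2At_eq F N θ.toStage9Params (datumOfRecord₁₃CoPHChi F N θ χ hP) g₀ os p g k hj hP.zetaMeas hP.zetaAbs hP.zetaUnity θtop δtop t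
      (fun s => integrable_chi_mul_dressedSlots_of_ppSelLive θ.toStage9Params E hsel hU hP.zetaMeas hζ0 hP.zetaAbs _ hD g₀ os hg t k s)]
    exact sum_classWeightOfDatum₉_eq_schemeZ_of_ppSelLive_of_localBg θ.toStage9Params E hsel hg hU hP.zetaMeas hζ0 hP.zetaAbs hP.zetaUnity
      (datumOfRecord₁₃CoPHChi F N θ χ hP) hD os t k (by omega)

variable (K₀ : ℕ) (g₀ : ℕ → ℝ) (os : List (ULoop F)) (ρ ρ' : ℕ → ℝ) (n₁ n₂ : ℕ → ℕ)

/-- run A: the class-set sum of the doubly-gapped χ-class weights is the sum over ALL top histories of the pair-lettered terms (fibre sums along `keyA₁₃Chi`). [bookkeeping] -/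
theorem sum_classSet₁₃Chi_gapWeight2A₁₃Chi (K : ℕ) (t : ℝ) :
    ∑ x ∈ classSet₁₃Chi θ χ K₀ g₀ K, gapWeight2A₁₃Chi θ χ hP K₀ g₀ os ρ ρ' n₁ n₂ K t x =
      ∑ s, topTerm2AtLevel F N θ.toStage9Params (datumOfRecord₁₃CoPHChi F N θ χ hP) g₀ os (runA₁₃ F K₀ g₀ K) (histA₁₃Chi θ χ K₀ g₀ K)
        (cutGrid θ.ν (histA₁₃Chi θ χ K₀ g₀ K) (K₀ + K) (ρ K) (selDepthA2₁₃Chi θ χ hP K₀ g₀ os ρ (n₁ K) K t + 1))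
        (bCutGrid θ.ν θ.A₁ (histA₁₃Chi θ χ K₀ g₀ K) (K₀ + K - 1) (ρ' K) (selDepthB2₁₃Chi θ χ hP K₀ g₀ os ρ' (n₂ K) K t + 1)) t (K₀ + K) s := by
  letI : ∀ Kc, DecidableEq (SiteSeqKey F Kc) := fun _ => Classical.decEq _
  exact Finset.sum_fiberwise_of_maps_to (s := Finset.univ) (t := classSet₁₃Chi θ χ K₀ g₀ K) (g := keyA₁₃Chi θ χ K₀ g₀ K)
    (fun s _ => Finset.mem_union_left _ (Finset.mem_image_of_mem _ (Finset.mem_univ s))) _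

/-- run B: the same along `keyB₁₃Chi`. [bookkeeping] -/
theorem sum_classSet₁₃Chi_gapWeight2B₁₃Chi (K : ℕ) (t : ℝ) :
    ∑ x ∈ classSet₁₃Chi θ χ K₀ g₀ K, gapWeight2B₁₃Chi θ χ hP K₀ g₀ os ρ ρ' n₁ n₂ K t x =
      ∑ s', topTerm2AtLevel F N θ.toStage9Params (datumOfRecord₁₃CoPHChi F N θ χ hP) g₀ os (runB₁₃ F K₀ g₀ K) (histB₁₃Chi θ χ K₀ g₀ K)
        (cutGrid θ.ν (histB₁₃Chi θ χ K₀ g₀ K) (K₀ + K + 1) (ρ K) (selDepthA2₁₃Chi θ χ hP K₀ g₀ os ρ (n₁ K) K t + 1))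
        (bCutGrid θ.ν θ.A₁ (histB₁₃Chi θ χ K₀ g₀ K) (K₀ + K) (ρ' K) (selDepthB2₁₃Chi θ χ hP K₀ g₀ os ρ' (n₂ K) K t + 1)) t (K₀ + K + 1) s' := by
  letI : ∀ Kc, DecidableEq (SiteSeqKey F Kc) := fun _ => Classical.decEq _
  exact Finset.sum_fiberwise_of_maps_to (s := Finset.univ) (t := classSet₁₃Chi θ χ K₀ g₀ K) (g := keyB₁₃Chi θ χ K₀ g₀ K)
    (fun s' _ => Finset.mem_union_right _ (Finset.mem_image_of_mem _ (Finset.mem_univ s'))) _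

/-- ★★ **E1 AT THE DOUBLY-GAPPED χ-CARRIERS**: on the live-selector line run A's doubly-gapped χ-class weights sum over the χ-class set to the run's dressed partition function of the
χ-datum — ANY dials `ρ ρ′ n₁ n₂`, every `K t` (the gap only re-letters the top indicator families; [LF-I] p.181 «we change the regularity conditions by a factor»).
[cite: Balaban1989LargeFieldI, (0.3)–(0.4) p.176, p.181; Balaban1988Convergent, (2.18) p.257 (bookkeeping)] -/
theorem sum_classSet₁₃Chi_gapWeight2A₁₃Chi_eq_schemeZ (E : B12.RunParams → ℝ) (hsel : θ.ppSel = ppSelLiveOfRecord F N θ.ν θ.τ9 E (wOfRecord₉ F N θ.toStage9Params))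
    (K : ℕ) (t : ℝ) :
    ∑ x ∈ classSet₁₃Chi θ χ K₀ g₀ K, gapWeight2A₁₃Chi θ χ hP K₀ g₀ os ρ ρ' n₁ n₂ K t x =
      T4GenFunBounds.schemeZ ((datumOfRecord₁₃CoPHChi F N θ χ hP).scheme g₀) os (K₀ + K) t := by
  rw [sum_classSet₁₃Chi_gapWeight2A₁₃Chi]
  exact sum_topTerm2AtLevel_eq_schemeZ_of_liveSel_chi θ χ hP E hsel g₀ os (p := runA₁₃ F K₀ g₀ K) (histA₁₃Chi_zero θ χ K₀ g₀ K) _ _ t (K₀ + K) rfl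

/-- ★★ **E2 AT THE DOUBLY-GAPPED χ-CARRIERS**: run B's (top `K₀ + K + 1`). [cite: Balaban1989LargeFieldI, (0.3)–(0.4) p.176, p.181; Balaban1988Convergent, (2.18) p.257 (bookkeeping)] -/
theorem sum_classSet₁₃Chi_gapWeight2B₁₃Chi_eq_schemeZ (E : B12.RunParams → ℝ) (hsel : θ.ppSel = ppSelLiveOfRecord F N θ.ν θ.τ9 E (wOfRecord₉ F N θ.toStage9Params))
    (K : ℕ) (t : ℝ) :
    ∑ x ∈ classSet₁₃Chi θ χ K₀ g₀ K, gapWeight2B₁₃Chi θ χ hP K₀ g₀ os ρ ρ' n₁ n₂ K t x =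
      T4GenFunBounds.schemeZ ((datumOfRecord₁₃CoPHChi F N θ χ hP).scheme g₀) os (K₀ + K + 1) t := by
  rw [sum_classSet₁₃Chi_gapWeight2B₁₃Chi]
  exact sum_topTerm2AtLevel_eq_schemeZ_of_liveSel_chi θ χ hP E hsel g₀ os (p := runB₁₃ F K₀ g₀ K) (histB₁₃Chi_zero θ χ K₀ g₀ K) _ _ t (K₀ + K + 1) rfl

end E1E2

/-! ## §2 The extraction face at the doubly-gapped χ-reading -/

section Extraction

variable (Χ : (F : T4Family) → Stage13Params F N → ChiSlot F N) (K₀ : ℕ) (jcut : ℕ → ℕ) (ρ ρ' : WidthLetter₁₃CoPHCmap N Χ) (n₁ n₂ : DepthLetter₁₃CoPHCmap N Χ)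
  (θ : Stage13HParams F N) (hP : θ.Provisos₁₃CoPHChi F N (Χ F θ.toStage13Params)) (g₀ : ℕ → ℝ) (os : List (ULoop F)) (E : B12.RunParams → ℝ)

/-- ★★ **THE EXTRACTION FACE AT THE DOUBLY-GAPPED χ-READING ON THE LIVE LINE** — `0 < l₀ = 1`, `0 < vol = F.side⁴`, E1 ∕ E2 at the reading's own class set and carriers (§1 through
dag-n15-a's `rfl` dictionary), every `Χ K₀ jcut ρ ρ′ n₁ n₂`, every χ-keyed tuple with `θ.ppSel` the live selector, every `g₀ os`; the χ-twin of dag-n21-d's `keyedExtraction_crGap2₁₃VAt`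
(without its `ForSmallCouplings` wrapper — add `ForSmallCouplings.of_forall`). [cite: Balaban1989LargeFieldI, (0.3)–(0.4) p.176, p.181 (bookkeeping)] -/
theorem extraction_crGap2₁₃VAtCmap_of_liveSel (hsel : θ.ppSel = ppSelLiveOfRecord F N θ.ν θ.τ9 E (wOfRecord₉ F N θ.toStage9Params)) :
    0 < (crGap2₁₃VAtCmap Χ K₀ jcut ρ ρ' n₁ n₂ F θ hP g₀ os).l₀ ∧ 0 < (crGap2₁₃VAtCmap Χ K₀ jcut ρ ρ' n₁ n₂ F θ hP g₀ os).vol ∧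
      (∀ (K : ℕ) (t : ℝ), |t| ≤ (crGap2₁₃VAtCmap Χ K₀ jcut ρ ρ' n₁ n₂ F θ hP g₀ os).l₀ →
        T4GenFunBounds.schemeZ ((datumOfRecord₁₃CoPHChi F N θ (Χ F θ.toStage13Params) hP).scheme g₀) os ((crGap2₁₃VAtCmap Χ K₀ jcut ρ ρ' n₁ n₂ F θ hP g₀ os).K₀ + K) t =
          ∑ τ ∈ (crGap2₁₃VAtCmap Χ K₀ jcut ρ ρ' n₁ n₂ F θ hP g₀ os).T K, (crGap2₁₃VAtCmap Χ K₀ jcut ρ ρ' n₁ n₂ F θ hP g₀ os).A K t τ) ∧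
      (∀ (K : ℕ) (t : ℝ), |t| ≤ (crGap2₁₃VAtCmap Χ K₀ jcut ρ ρ' n₁ n₂ F θ hP g₀ os).l₀ →
        T4GenFunBounds.schemeZ ((datumOfRecord₁₃CoPHChi F N θ (Χ F θ.toStage13Params) hP).scheme g₀) os ((crGap2₁₃VAtCmap Χ K₀ jcut ρ ρ' n₁ n₂ F θ hP g₀ os).K₀ + K + 1) t =
          ∑ τ ∈ (crGap2₁₃VAtCmap Χ K₀ jcut ρ ρ' n₁ n₂ F θ hP g₀ os).T K, (crGap2₁₃VAtCmap Χ K₀ jcut ρ ρ' n₁ n₂ F θ hP g₀ os).B K t τ) :=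
  ⟨one_pos, pow_pos F.side_pos 4,
    fun K t _ => (sum_classSet₁₃Chi_gapWeight2A₁₃Chi_eq_schemeZ θ (Χ F θ.toStage13Params) hP K₀ g₀ os _ _ _ _ E hsel K t).symm,
    fun K t _ => (sum_classSet₁₃Chi_gapWeight2B₁₃Chi_eq_schemeZ θ (Χ F θ.toStage13Params) hP K₀ g₀ os _ _ _ _ E hsel K t).symm⟩

end Extraction

/-! ## §3 At the K3ᴬ v8 mirror (`N = 2`): the N27x conjunct on the gap-pinned split reading is a THEOREM, any cut reading -/

section GapPin

variable (jc : CutReading) (ρ ρ' : WidthLetter₁₃CoPHAx 2) (n₁ n₂ : DepthLetter₁₃CoPHAx 2)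

/-- ★★★ **v8's N27x FACES ON THE GAP-PINNED SPLIT READING — THEOREMS, ANY CUT READING `jc`**: for a reading `cr` satisfying v8's OWN pin `PinnedAtLiveGap2 jc ρ ρ′ n₁ n₂ cr` and the
off-live pin to `crOneTerm₁₃Ax 0` (✓p813406), BOTH the (B)-free extraction face `KeyedExtractionBFree cr` and the slot-keyed conjunct `KeyedExtractionV cr` hold — on the live line
§2 at the re-centred reading (`Χ := chiβOfRecord₁₃Ax`, `K₀ := 0`, `E := EOfRecord₁₃Ax …` = v8's `LiveSel`), off it the one-term reading's singleton-sum identities; the provisos' own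
rows carry (H-ζ), nothing else is asked.  HYPOTHESIS-FREE beyond the two pins. [cite: Balaban1989LargeFieldI, (0.3)–(0.4) p.176, p.181 (bookkeeping)] -/
theorem keyedExtraction_faces_of_liveGap2Pin {cr : SpineReading} (hon : PinnedAtLiveGap2 jc ρ ρ' n₁ n₂ cr)
    (hoff : ∀ (F : T4Family) (θ : Stage13HParams F 2) (hP : θ.Provisos₁₃CoPHAx F 2) (g₀ : ℕ → ℝ) (os : List (ULoop F)),
      ¬ LiveSel F θ → cr F θ hP g₀ os = crOneTerm₁₃Ax 0 F θ hP g₀ os) :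
    KeyedExtractionBFree cr ∧ KeyedExtractionV cr :=
  have hB : KeyedExtractionBFree cr :=
    keyedExtractionBFree_of_livePin (crL := fun F θ hP g₀ os => crGap2₁₃VAx (jc F θ hP g₀ os) ρ ρ' n₁ n₂ F θ hP g₀ os) hon hoff fun F θ hP hG _ =>
      ForSmallCouplings.of_forall fun g₀ os =>
        extraction_crGap2₁₃VAtCmap_of_liveSel (fun F => chiβOfRecord₁₃Ax F 2) 0 (jc F θ hP g₀ os) ρ ρ' n₁ n₂ θ hP g₀ os (EOfRecord₁₃Ax F 2 θ.toStage13Params) hG.2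
  ⟨hB, keyedExtractionV_of_bFree hB⟩

/-- ★★ **THE GAP-PINNED SPLIT READING EXISTS AND CARRIES v8's N27x CONJUNCT, ANY CUT READING** (`exists_reading_livePin` at `crL := fun … ↦ crGap2₁₃VAx (jc …) ρ ρ′ n₁ n₂ …`; its
pin clauses + the previous theorem): a v8 stub-2 supplier at the cut reading `jc` takes THIS `cr`. [cite: Balaban1989LargeFieldI, (0.3)–(0.4) p.176, p.181 (bookkeeping)] -/
theorem exists_gap2PinnedSplitReading_extractionV :
    ∃ cr : SpineReading, PinnedAtLiveGap2 jc ρ ρ' n₁ n₂ cr ∧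
      (∀ (F : T4Family) (θ : Stage13HParams F 2) (hP : θ.Provisos₁₃CoPHAx F 2) (g₀ : ℕ → ℝ) (os : List (ULoop F)),
        ¬ LiveSel F θ → cr F θ hP g₀ os = crOneTerm₁₃Ax 0 F θ hP g₀ os) ∧
      KeyedExtractionV cr := by
  obtain ⟨cr, hon, hoff⟩ := exists_reading_livePin (fun F θ hP g₀ os => crGap2₁₃VAx (jc F θ hP g₀ os) ρ ρ' n₁ n₂ F θ hP g₀ os)
  exact ⟨cr, hon, hoff, (keyedExtraction_faces_of_liveGap2Pin jc ρ ρ' n₁ n₂ hon hoff).2⟩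

/-- ★★ **… AND AT THE ZERO CUT READING IT ALSO CARRIES v8's N20 CONJUNCT** (✓p813406 `keyedRelWeight_of_liveGap2Pin_cutZero`): pin ∧ off-live pin ∧ `KeyedRelWeight cr ∧
KeyedExtractionV cr` — the two N20-lineage-served conjuncts of `stub_expansion13HV` on one reading, by name. [cite: Balaban1989LargeFieldII, (1.80) p.384; Balaban1989LargeFieldI, (0.3)–(0.4) p.176 (bookkeeping)] -/
theorem exists_gap2PinnedSplitReading_relWeight_extractionV_cutZero :
    ∃ cr : SpineReading, PinnedAtLiveGap2 (fun _ _ _ _ _ => fun _ => 0) ρ ρ' n₁ n₂ cr ∧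
      (∀ (F : T4Family) (θ : Stage13HParams F 2) (hP : θ.Provisos₁₃CoPHAx F 2) (g₀ : ℕ → ℝ) (os : List (ULoop F)),
        ¬ LiveSel F θ → cr F θ hP g₀ os = crOneTerm₁₃Ax 0 F θ hP g₀ os) ∧
      KeyedRelWeight cr ∧ KeyedExtractionV cr := by
  obtain ⟨cr, hon, hoff⟩ := exists_reading_livePin (crGap2₁₃VAx (N := 2) (fun _ => 0) ρ ρ' n₁ n₂)
  exact ⟨cr, hon, hoff, keyedRelWeight_of_liveGap2Pin_cutZero ρ ρ' n₁ n₂ hoff hon,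
    (keyedExtraction_faces_of_liveGap2Pin (fun _ _ _ _ _ => fun _ => 0) ρ ρ' n₁ n₂ hon hoff).2⟩

end GapPin

/-! ## §4 The stub-2 bill on the split reading at the zero cut reading — node N20, N27x and the pin paid -/

/-- **★★ THE REGISTERED STUB-2 TEXT FROM THE DIAL ROWS + N21's SHELL BOUND AND N19′'s CORE ON THE LIVE LINE + NODE U5's TARGET OFF IT** (all at the cut-zero doubly-gapped RE-CENTRED
reading `crGap2₁₃VAx (fun _ ↦ 0) ρ ρ′ n₁ n₂`; the OTHER lanes' content, HYPOTHESES asserted for no family; NE7 ∕ NE7c NOT PRINTED for `d = 4`): ✓p813406's split bill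
`stub2Text_of_liveFaces_cutZero` with its N27x hypothesis DISCHARGED by §3.  The conclusion is `K3Skeleton13SepCoPHAxV8.stub_expansion13HV`'s type ∕ `K3AxV8StubTexts.Stub2TextV8`
byte for byte; NO stub is proved here. [cite: Balaban1989LargeFieldII, Thm 1 + (0.1) pp.355–356, (1.80) p.384; King1986, (3.10)–(3.11) p.656 (bookkeeping)] -/
theorem stub2Text_of_liveShellCore_cutZero
    (h : ∀ β : ℝ, 2 / 3 < β → β < 1 →
      ∀ (𝔯 : RateReading13AxP) (ksel : RunSel) (ℓ : LetterReading) (ℓ₃ : T4Family → Node00.NE3Letters₁₁) (g B : T4Family → ℝ),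
        GuardedReadingN16 𝔯 ksel ℓ ℓ₃ g B → KeyedRatesHolderD4V β (rrOfRecord 𝔯 ksel) →
        ∃ (ρ ρ' : WidthLetter₁₃CoPHAx 2) (n₁ n₂ : DepthLetter₁₃CoPHAx 2), DialRows ρ ρ' n₁ n₂ ∧
          (∀ (F : T4Family) (θ : Stage13HParams F 2) (hP : θ.Provisos₁₃CoPHAx F 2), ((θ.ZhUnity F 2 ∧ θ.SlotsNondegenerate₁₃Ax F 2) ∧ LiveSel F θ) → θ.Admissible F 2 →
            ∀ (g₀ : ℕ → ℝ) (os : List (ULoop F)),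
              ShellWeightBound (crGap2₁₃VAx (fun _ => 0) ρ ρ' n₁ n₂ F θ hP g₀ os).l₀ (crGap2₁₃VAx (fun _ => 0) ρ ρ' n₁ n₂ F θ hP g₀ os).T
                (crGap2₁₃VAx (fun _ => 0) ρ ρ' n₁ n₂ F θ hP g₀ os).A (crGap2₁₃VAx (fun _ => 0) ρ ρ' n₁ n₂ F θ hP g₀ os).B
                (crGap2₁₃VAx (fun _ => 0) ρ ρ' n₁ n₂ F θ hP g₀ os).shA (crGap2₁₃VAx (fun _ => 0) ρ ρ' n₁ n₂ F θ hP g₀ os).shB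
                (crGap2₁₃VAx (fun _ => 0) ρ ρ' n₁ n₂ F θ hP g₀ os).Wsh) ∧
          (∀ (F : T4Family) (θ : Stage13HParams F 2) (h : θ.Provisos₁₃SepCoPHAx F 2) (v : Revision₁₃Ax F 2 θ h),
            ((θ.ZhUnity F 2 ∧ θ.SlotsNondegenerate₁₃Ax F 2) ∧ LiveSel F θ) → θ.Admissible F 2 →
            B16.EndStatementBPrinted (datumOfRecord₁₃SepCoPHVAx F 2 θ h v).C → DagBinding.EndpointExistence (datumOfRecord₁₃SepCoPHVAx F 2 θ h v).C.toB12 →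
              ForSmallCouplings (datumOfRecord₁₃SepCoPHVAx F 2 θ h v) fun g₀ => ∀ os : List (ULoop F),
                PHolderD4 β (datumOfRecord₁₃SepCoPHVAx F 2 θ h v) (rrOfRecord 𝔯 ksel F θ h.toCore g₀ os) →
                  letI := (crGap2₁₃VAx (fun _ => 0) ρ ρ' n₁ n₂ F θ h.toCore g₀ os).dec
                  ∃ δ : ℕ → ℝ, NE7.Core (crGap2₁₃VAx (fun _ => 0) ρ ρ' n₁ n₂ F θ h.toCore g₀ os).l₀ (crGap2₁₃VAx (fun _ => 0) ρ ρ' n₁ n₂ F θ h.toCore g₀ os).vol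
                    (crGap2₁₃VAx (fun _ => 0) ρ ρ' n₁ n₂ F θ h.toCore g₀ os).T (crGap2₁₃VAx (fun _ => 0) ρ ρ' n₁ n₂ F θ h.toCore g₀ os).Bad
                    (fun K t τ => (crGap2₁₃VAx (fun _ => 0) ρ ρ' n₁ n₂ F θ h.toCore g₀ os).A K t τ - (crGap2₁₃VAx (fun _ => 0) ρ ρ' n₁ n₂ F θ h.toCore g₀ os).shA K t τ)
                    (fun K t τ => (crGap2₁₃VAx (fun _ => 0) ρ ρ' n₁ n₂ F θ h.toCore g₀ os).B K t τ - (crGap2₁₃VAx (fun _ => 0) ρ ρ' n₁ n₂ F θ h.toCore g₀ os).shB K t τ) δ ∧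
                    Summable δ) ∧
          (∀ (F : T4Family) (θ : Stage13HParams F 2) (hP : θ.Provisos₁₃CoPHAx F 2), ((θ.ZhUnity F 2 ∧ θ.SlotsNondegenerate₁₃Ax F 2) ∧ ¬ LiveSel F θ) →
            θ.Admissible F 2 → ∀ (g₀ : ℕ → ℝ) (os : List (ULoop F)), PHolderD4 β (datumOfRecord₁₃CoPHAx F 2 θ hP) (rrOfRecord 𝔯 ksel F θ hP g₀ os) →
              ∃ δ : ℕ → ℝ, NE7.Target ((F.side : ℝ) ^ 4) 1 δ (fun K => T4GenFunBounds.schemeZ ((datumOfRecord₁₃CoPHAx F 2 θ hP).scheme g₀) os (0 + K)))) :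
    ∀ β : ℝ, 2 / 3 < β → β < 1 →
      ∀ (𝔯 : RateReading13AxP) (ksel : RunSel) (ℓ : LetterReading) (ℓ₃ : T4Family → Node00.NE3Letters₁₁) (g B : T4Family → ℝ),
        GuardedReadingN16 𝔯 ksel ℓ ℓ₃ g B → KeyedRatesHolderD4V β (rrOfRecord 𝔯 ksel) →
        ∃ (jc : CutReading) (ρ ρ' : WidthLetter₁₃CoPHAx 2) (n₁ n₂ : DepthLetter₁₃CoPHAx 2) (cr : SpineReading), PinnedAtLiveGap2 jc ρ ρ' n₁ n₂ cr ∧ DialRows ρ ρ' n₁ n₂ ∧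
          KeyedRelWeight cr ∧ KeyedShellWeight cr ∧ KeyedExtractionV cr ∧ KeyedCoreEdgeHolderD4V β cr (rrOfRecord 𝔯 ksel) := by
  intro β hβ hβ' 𝔯 ksel ℓ ℓ₃ g B hg hr
  obtain ⟨ρ, ρ', n₁, n₂, hd, h21, h19, hoff19⟩ := h β hβ hβ' 𝔯 ksel ℓ ℓ₃ g B hg hr
  obtain ⟨cr, hon, hoff⟩ := exists_reading_livePin (crGap2₁₃VAx (fun _ => 0) ρ ρ' n₁ n₂)
  exact ⟨fun _ _ _ _ _ => fun _ => 0, ρ, ρ', n₁, n₂, cr, hon, hd, keyedRelWeight_of_liveGap2Pin_cutZero ρ ρ' n₁ n₂ hoff hon,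
    keyedShellWeight_of_livePin hon hoff h21, (keyedExtraction_faces_of_liveGap2Pin (fun _ _ _ _ _ => fun _ => 0) ρ ρ' n₁ n₂ hon hoff).2,
    keyedCoreEdgeHolderD4V_of_livePin hon hoff β (rrOfRecord 𝔯 ksel) h19 hoff19⟩

end Summit.QuantumFields.YangMills.Theorems.N21GappedTopPair13CoPH

end
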